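import Mathlib
import Literature.Computability.AlgebraicComplexity.PermanentIrreducible
import Summits.ValiantsHypothesis.ValiantsHypothesis.Theses.DivisionGap

/-!
# Sketch — crux-ideate stmt-ValiantsHypothesis-5068 (PerMultiplesHard), round 1, ideator 1

First lemmas / statements for the two idea cards
* `twin-closure-pincer`  (sections Pincer…)
* `torus-zero-dual-cone` (section TorusZeros)

Everything is stated over existing declarations:
`Literature.Computability.AlgebraicComplexity.complexity`, `perPoly`,
`Summit.ValiantsHypothesis.ValiantsHypothesis.Theses.DivisionGap.PerMultiplesHard`.
Proofs are NOT required at this stage (crux-ideate); `sorry` marks the stubs a crux-plan would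
register.  The isolation lemma is proved in full (it is the combinatorial core of Tool 1).
-/

noncomputable section

set_option linter.dupNamespace false

open scoped BigOperators
open MvPolynomial Finset
open Literature.Computability.AlgebraicComplexity
open Summit.ValiantsHypothesis.ValiantsHypothesis.Theses.DivisionGap (PerMultiplesHard)

namespace Summit.ValiantsHypothesis.ValiantsHypothesis.Cruxes.PerMultiplesHard.Ideator1

/-! ## Unit-margin (pure) cofactors: positive combinations of permutation monomials -/

/-- The permutation monomial `x^{P_σ} = X^{permMonomial σ}` (`= ∏ i, X (σ i, i)`, column-major as in
`perPoly`; `permMonomial` is the tree's exponent vector, PermanentIrreducible.lean). -/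
def permMon {n : ℕ} (σ : Equiv.Perm (Fin n)) : MvPolynomial (Fin n × Fin n) NNReal :=
  monomial (permMonomial σ) 1

/-- A unit-margin cofactor: `h_S = Σ_{σ ∈ S} c_σ x^{P_σ}` with a coefficient function `c`. These are
exactly the torus-homogeneous cofactors of margin type `(𝟙, 𝟙)`. -/
def permSum {n : ℕ} (S : Finset (Equiv.Perm (Fin n))) (c : Equiv.Perm (Fin n) → NNReal) :
    MvPolynomial (Fin n × Fin n) NNReal :=
  ∑ σ ∈ S, c σ • permMon σ

/-- The crux restricted to unit-margin cofactors ("the permanent times any positive combination of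
permutation monomials is super-quasi-polynomially hard"). Special case of `PerMultiplesHard`. -/
def UnitMarginMultiplesHard : Prop :=
  ∀ k : ℕ, ∃ n₀ : ℕ, ∀ n ≥ n₀, ∀ S : Finset (Equiv.Perm (Fin n)), S.Nonempty →
    ∀ c : Equiv.Perm (Fin n) → NNReal, (∀ σ ∈ S, 0 < c σ) →
      2 ^ ((Nat.log 2 n + k) ^ k) < complexity (perPoly (Fin n) NNReal * permSum S c)

/-- `permSum S c ≠ 0` when `S` is nonempty and coefficients are positive (coefficient of `x^{P_σ}`
is `c σ`; permutation monomials are distinct). -/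
theorem permSum_ne_zero {n : ℕ} {S : Finset (Equiv.Perm (Fin n))} (hS : S.Nonempty)
    {c : Equiv.Perm (Fin n) → NNReal} (hc : ∀ σ ∈ S, 0 < c σ) : permSum S c ≠ 0 := by
  classical
  obtain ⟨σ, hσ⟩ := hS
  intro h0
  have hcoeff : coeff (permMonomial σ) (permSum S c) = c σ := by
    simp only [permSum, permMon, coeff_sum, coeff_smul, coeff_monomial, smul_eq_mul]
    rw [Finset.sum_eq_single σ]
    · simp
    · intro τ _ hτσ
      simp [permMonomial_injective.ne hτσ]
    · intro h
      exact absurd hσ h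
  rw [h0, coeff_zero] at hcoeff
  exact (hc σ hσ).ne hcoeff

/-- The unit-margin case is an instance of the crux. -/
theorem unitMargin_of_perMultiplesHard (H : PerMultiplesHard) : UnitMarginMultiplesHard := by
  intro k
  obtain ⟨n₀, hn₀⟩ := H k
  refine ⟨n₀, fun n hn S hS c hc => ?_⟩
  exact hn₀ n hn (permSum S c) (permSum_ne_zero hS hc)

/-! ## Tool 1 — faces of the Birkhoff polytope: off-sets, twins, defence, isolation -/

/-- The OFF-SET of `σ` w.r.t. a bipartite graph `G ⊆ [n]²` (edge `(σ i, i)` = row `σ i`, column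
`i`): the edges of `σ` outside `G`. On the face of `B_n` exposed by `G`, the top fibre of `h_S`
consists of the `σ ∈ S` minimising a generic positive slack functional of the off-set. -/
def offSet {n : ℕ} (G : Finset (Fin n × Fin n)) (σ : Equiv.Perm (Fin n)) : Finset (Fin n × Fin n) :=
  (univ.image fun i : Fin n => (σ i, i)).filter fun e => e ∉ G

/-- `σ` is OFF-SET-MINIMAL in `S` w.r.t. `G`: no `τ ∈ S` has a strictly smaller off-set. -/
def IsOffsetMinimal {n : ℕ} (G : Finset (Fin n × Fin n)) (S : Finset (Equiv.Perm (Fin n)))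
    (σ : Equiv.Perm (Fin n)) : Prop :=
  σ ∈ S ∧ ∀ τ ∈ S, ¬ offSet G τ ⊂ offSet G σ

/-- `τ` is a `G`-TWIN of `σ` inside `S`: a different element with the same off-set (equivalently
`σ Δ τ` is a union of `σ`-alternating cycles of `G`). -/
def IsTwin {n : ℕ} (G : Finset (Fin n × Fin n)) (S : Finset (Equiv.Perm (Fin n)))
    (σ τ : Equiv.Perm (Fin n)) : Prop :=
  τ ∈ S ∧ τ ≠ σ ∧ offSet G τ = offSet G σ

/-- `S` DEFENDS the graph `G`: every off-set-minimal element of `S` has a `G`-twin in `S`.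
(If `S` does not defend `G`, some top fibre of `h_S` on the face of `G` is a singleton.) -/
def Defends {n : ℕ} (S : Finset (Equiv.Perm (Fin n))) (G : Finset (Fin n × Fin n)) : Prop :=
  ∀ σ, IsOffsetMinimal G S σ → ∃ τ, IsTwin G S σ τ

/-- Relabelled copy (placement) of a template graph. -/
def place {n : ℕ} (G : Finset (Fin n × Fin n)) (ρ κ : Equiv.Perm (Fin n)) :
    Finset (Fin n × Fin n) :=
  G.map (Equiv.prodCongr ρ κ).toEmbedding

/-- `S` defends EVERY placement of the template `G`. -/
def DefendsAllPlacements {n : ℕ} (S : Finset (Equiv.Perm (Fin n))) (G : Finset (Fin n × Fin n)) :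
    Prop :=
  ∀ ρ κ : Equiv.Perm (Fin n), Defends S (place G ρ κ)

/-- **ISOLATION LEMMA** (combinatorial core of Tool 1, proved). If `σ₀ ∈ S` is off-set-minimal
w.r.t. `G` and has no `G`-twin in `S`, then there are nonnegative integer slacks `s`, zero on `G`,
for which `σ₀` is the UNIQUE minimiser over `S` of the slack `Σ_i s (σ i, i)`. With `w := -s`,
`in_w(per_n) = per(G)` (if `G` has a perfect matching) and `in_w(h_S) = c σ₀ • x^{P_{σ₀}}`. -/
theorem isolation {n : ℕ} (S : Finset (Equiv.Perm (Fin n))) (G : Finset (Fin n × Fin n))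
    (σ₀ : Equiv.Perm (Fin n)) (hmin : IsOffsetMinimal G S σ₀)
    (hnotwin : ∀ τ ∈ S, offSet G τ = offSet G σ₀ → τ = σ₀) :
    ∃ s : Fin n × Fin n → ℕ, (∀ e ∈ G, s e = 0) ∧
      ∀ τ ∈ S, τ ≠ σ₀ → (∑ i : Fin n, s (σ₀ i, i)) < ∑ i : Fin n, s (τ i, i) := by
  classical
  -- slack 0 on G, 1 on the off-set of σ₀, n+1 on every other entry
  refine ⟨fun e => if e ∈ G then 0 else if e ∈ offSet G σ₀ then 1 else n + 1, ?_, ?_⟩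
  · intro e he
    simp [he]
  · intro τ hτ hne
    dsimp only
    -- every edge of σ₀ costs at most 1, so the σ₀-sum is at most n
    have h0 : ∀ i : Fin n,
        (if (σ₀ i, i) ∈ G then 0 else if (σ₀ i, i) ∈ offSet G σ₀ then 1 else n + 1) ≤ 1 := by
      intro i
      by_cases hG : (σ₀ i, i) ∈ G
      · simp [hG]
      · have hmem : (σ₀ i, i) ∈ offSet G σ₀ := by
          simp only [offSet, Finset.mem_filter, Finset.mem_image, Finset.mem_univ, true_and]
          exact ⟨⟨i, rfl⟩, hG⟩
        simp [hG, hmem]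
    have hσsum : (∑ i : Fin n,
        (if (σ₀ i, i) ∈ G then 0 else if (σ₀ i, i) ∈ offSet G σ₀ then 1 else n + 1)) ≤ n := by
      calc (∑ i : Fin n,
            (if (σ₀ i, i) ∈ G then 0 else if (σ₀ i, i) ∈ offSet G σ₀ then 1 else n + 1))
          ≤ ∑ _i : Fin n, 1 := Finset.sum_le_sum fun i _ => h0 i
        _ = n := by simp
    by_cases hbad : ∃ i : Fin n, (τ i, i) ∉ G ∧ (τ i, i) ∉ offSet G σ₀
    · -- an edge of τ outside G ∪ offSet(σ₀) alone costs n + 1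
      obtain ⟨i, hiG, hiO⟩ := hbad
      have hbig : n + 1 ≤ ∑ j : Fin n,
          (if (τ j, j) ∈ G then 0 else if (τ j, j) ∈ offSet G σ₀ then 1 else n + 1) := by
        have hterm : (if (τ i, i) ∈ G then 0 else if (τ i, i) ∈ offSet G σ₀ then 1 else n + 1)
            = n + 1 := by simp [hiG, hiO]
        calc n + 1 = (if (τ i, i) ∈ G then 0 else if (τ i, i) ∈ offSet G σ₀ then 1 else n + 1) :=
              hterm.symm
          _ ≤ ∑ j : Fin n,
              (if (τ j, j) ∈ G then 0 else if (τ j, j) ∈ offSet G σ₀ then 1 else n + 1) :=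
            Finset.single_le_sum
              (f := fun j : Fin n =>
                (if (τ j, j) ∈ G then 0 else if (τ j, j) ∈ offSet G σ₀ then 1 else n + 1))
              (fun j _ => Nat.zero_le _) (Finset.mem_univ i)
      omega
    · -- otherwise offSet G τ ⊆ offSet G σ₀; minimality and no-twin force τ = σ₀
      push Not at hbad
      have hsub : offSet G τ ⊆ offSet G σ₀ := by
        intro e he
        simp only [offSet, Finset.mem_filter, Finset.mem_image, Finset.mem_univ, true_and] at he
        obtain ⟨⟨i, rfl⟩, heG⟩ := he
        exact hbad i heG
      have heq : offSet G τ = offSet G σ₀ := by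
        by_contra hneq
        exact hmin.2 τ hτ (Finset.ssubset_iff_subset_ne.mpr ⟨hsub, hneq⟩)
      exact absurd (hnotwin τ hτ heq) hne

/-- The perfect-matching polynomial of the bipartite graph `G ⊆ [n]²` (the face of the Birkhoff
polytope exposed by `G`): `per(G) = Σ_{σ ⊆ G} x^{P_σ}`. -/
def facePer {n : ℕ} (G : Finset (Fin n × Fin n)) : MvPolynomial (Fin n × Fin n) NNReal :=
  ∑ σ ∈ univ.filter (fun σ : Equiv.Perm (Fin n) => ∀ i, (σ i, i) ∈ G), permMon σ

/-- **FACE ISOLATION** (Tool 1 as a statement about `complexity`; = leading forms are free +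
multiplicativity of leading forms + isolation): if `G` carries a perfect matching and `σ₀` is an
untwinned off-set-minimal element of `S`, then the monomial multiple `x^{P_{σ₀}} · per(G)` is no
harder than `per_n · h_S` (up to the one gate absorbing the scalar `c σ₀`). -/
def FaceIsolation : Prop :=
  ∀ (n : ℕ) (S : Finset (Equiv.Perm (Fin n))) (c : Equiv.Perm (Fin n) → NNReal)
    (G : Finset (Fin n × Fin n)) (σ₀ : Equiv.Perm (Fin n)),
    (∀ σ ∈ S, 0 < c σ) → (∃ π : Equiv.Perm (Fin n), ∀ i, (π i, i) ∈ G) →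
    IsOffsetMinimal G S σ₀ → (∀ τ ∈ S, offSet G τ = offSet G σ₀ → τ = σ₀) →
      complexity (permMon σ₀ * facePer G) ≤ complexity (perPoly (Fin n) NNReal * permSum S c) + 1

/-- **MONOMIAL STRIPPING** (Jukna–Seiwert–Sergeev 2022 Thm 1 / Jukna 2023 Thm 6.11, Rem 6.19, in
the tree's model; unproved here): dividing by a monomial costs at most a quadratic blow-up. -/
def MonomialStripping : Prop :=
  ∃ K : ℕ, ∀ (n : ℕ) (σ₀ : Equiv.Perm (Fin n)) (f : MvPolynomial (Fin n × Fin n) NNReal),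
    complexity f ≤ K * (n * n + 1) ^ 3 * (complexity (permMon σ₀ * f) + 1) ^ 2

/-! ## Tool 2 — density: the typed vertex-rectangle count for unit-margin cofactors -/

/-- **TYPED VERTEX BOUND, unit-margin case** (row-support-balanced structure theorem + torus typing
of gates; the pure monomials `2·P_π`, `π ∈ S`, of `per · h_S` are covered at most `|R|!(n-|R|)!`
at a time; cf. Cruxes/PerDivisionHard/Ideas/typed-vertex-rectangles.md, Jukna 2023 Thm 3.6(1)
for `S = {all}` read as `M = 1`). Unproved here. -/
def TypedVertexBoundUnit : Prop :=
  ∀ n ≥ 3, ∀ (S : Finset (Equiv.Perm (Fin n))) (c : Equiv.Perm (Fin n) → NNReal),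
    (∀ σ ∈ S, 0 < c σ) →
      S.card * n.choose ((n + 2) / 3) ≤ n.factorial * complexity (perPoly (Fin n) NNReal * permSum S c)

/-! ## The new conjecture: TWIN CLOSURE (defence forces density) -/

/-- A template family: one bipartite graph `G₀ n ⊆ [n]²` per `n` (intended: a 3-regular bipartite
expander with every edge subdivided into a path with `2L` inner vertices, padded by a perfect
matching; it has a perfect matching, `2^{Ω(n/(dL))}`-hard matching polynomial, and only
`n·(d-1)^{ℓ/(2L+1)}` cycles of length `ℓ`; intended `d` a large constant, `L ≈ 2 log₂ n`). -/
abbrev Template := ∀ n : ℕ, Finset (Fin n × Fin n)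

/-- **TWIN-CLOSURE CONJECTURE `TC(G₀, δ)`**: a set of permutations that defends every placement of
the template is `δ`-dense. (For the intended templates the conjectured rate is `δ n = 2^{-ε n}`
with `ε < 0.9`, which is all Tool 2 needs: `C(n,⌈n/3⌉) ≈ 2^{0.918 n}`.) -/
def TwinClosure (G₀ : Template) (δ : ℕ → ℝ) : Prop :=
  ∃ n₀ : ℕ, ∀ n ≥ n₀, ∀ S : Finset (Equiv.Perm (Fin n)), S.Nonempty →
    DefendsAllPlacements S (G₀ n) → δ n * (n.factorial : ℝ) ≤ (S.card : ℝ)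

/-- The set of perfect matchings of a bipartite graph `H' ⊆ [n]²`, as permutations ("matching-closed" sets). -/
def pmSet {n : ℕ} (H' : Finset (Fin n × Fin n)) : Finset (Equiv.Perm (Fin n)) :=
  univ.filter fun σ : Equiv.Perm (Fin n) => ∀ i, (σ i, i) ∈ H'

/-- **TC FOR MATCHING-CLOSED SETS** (provable special case, König): if `S = PM(H')` defends every placement
of a template whose cycles are cut by `t n` path-edges (feedback number of the subdivided expander,
`t n ≈ (d-2)·n/(dL+1)`), then the complement of `H'` has matching number `≤ t n`, hence is covered by
`≤ t n` lines, hence `|S| ≥ (n - t n)!` (`≥ 2^{-n/2}·n!` once `L ≥ 2 log₂ n`). -/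
def TwinClosureMatchingClosed (G₀ : Template) (t : ℕ → ℕ) : Prop :=
  ∀ (n : ℕ) (H' : Finset (Fin n × Fin n)), (pmSet H').Nonempty →
    DefendsAllPlacements (pmSet H') (G₀ n) → (n - t n).factorial ≤ (pmSet H').card

/-- **HARD TEMPLATE FACES**: every placement of `G₀ n` has a perfect matching and a
super-quasi-polynomially hard matching polynomial, with room for the quadratic stripping loss. -/
def HardTemplate (G₀ : Template) : Prop :=
  (∀ n, ∃ π : Equiv.Perm (Fin n), ∀ i, (π i, i) ∈ G₀ n) ∧
  ∀ k : ℕ, ∃ n₀ : ℕ, ∀ n ≥ n₀, ∀ ρ κ : Equiv.Perm (Fin n),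
    (2 ^ ((Nat.log 2 n + k) ^ k) + 2) ^ 2 * (k * (n * n + 1) ^ 3 + 1)
      < complexity (facePer (place (G₀ n) ρ κ))

/-- Density rate sufficient for Tool 2: `δ n · C(n,⌈n/3⌉)` beats every quasi-polynomial. -/
def SufficientDensity (δ : ℕ → ℝ) : Prop :=
  ∀ k : ℕ, ∃ n₀ : ℕ, ∀ n ≥ n₀, (2 : ℝ) ^ ((Nat.log 2 n + k) ^ k) < δ n * (n.choose ((n + 2) / 3) : ℝ)

/-- **THE PINCER** (composition; paper proof: if `S` fails to defend some placement, Tool 1 +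
stripping + hard faces; otherwise `TC` makes `S` dense and Tool 2 applies). -/
theorem unitMarginMultiplesHard_of_pincer (G₀ : Template) (δ : ℕ → ℝ)
    (hT2 : TypedVertexBoundUnit) (hT1 : FaceIsolation) (hJSS : MonomialStripping)
    (hTC : TwinClosure G₀ δ) (hG : HardTemplate G₀) (hδ : SufficientDensity δ) :
    UnitMarginMultiplesHard := by
  sorry

/-- **MATCHING COFACTORS** (the TC-free payoff): the permanent times any positive combination of the
perfect matchings of ANY bipartite graph `H'` is super-quasi-polynomially hard. -/
def MatchingCofactorsHard : Prop :=
  ∀ k : ℕ, ∃ n₀ : ℕ, ∀ n ≥ n₀, ∀ (H' : Finset (Fin n × Fin n)), (pmSet H').Nonempty →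
    ∀ c : Equiv.Perm (Fin n) → NNReal, (∀ σ ∈ pmSet H', 0 < c σ) →
      2 ^ ((Nat.log 2 n + k) ^ k) < complexity (perPoly (Fin n) NNReal * permSum (pmSet H') c)

/-- Composition for matching-closed cofactors: NO twin-closure conjecture is needed, only its König
special case (provable) — paper proof: if some placement of the template is undefended, FaceIsolation +
stripping + HardTemplate; otherwise `TwinClosureMatchingClosed` gives `|PM(H')| ≥ (n - t n)! ≥ 2^{-n/2} n!`
and `TypedVertexBoundUnit` finishes (`C(n,⌈n/3⌉) ≈ 2^{0.918 n}`). -/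
theorem matchingCofactorsHard_of_tools (G₀ : Template) (t : ℕ → ℕ)
    (hT2 : TypedVertexBoundUnit) (hT1 : FaceIsolation) (hJSS : MonomialStripping)
    (hK : TwinClosureMatchingClosed G₀ t) (hG : HardTemplate G₀)
    (ht : ∃ n₀, ∀ n ≥ n₀, 2 * t n * Nat.log 2 n ≤ n) :
    MatchingCofactorsHard := by
  sorry

/-! ## Card `torus-zero-dual-cone`: the h-free identities — zeros of `per` on the unit torus -/

/-- **ROOT-OF-UNITY ROW BLOCKS ARE ZEROS OF EVERY MULTIPLE OF `per`.** For `1 ≤ |K| ≤ n-1` and a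
primitive `n`-th root of unity `ω`, the point `E_{rc} = ω^c (r ∈ K), 1 (r ∉ K)` kills `per_n`
(`per(E) = |K|!(n-|K|)!·e_{|K|}(1, ω, …, ω^{n-1}) = 0`), hence kills `per_n · h` for EVERY `h`.
(First lemma of the card; provable now: `eval` is multiplicative and `∏_c (X - ω^c) = X^n - 1`.) -/
theorem eval_rootBlock_perPoly_mul {n : ℕ} (K : Finset (Fin n)) (hK : 0 < K.card)
    (hKn : K.card < n) (ω : ℂ) (hω : IsPrimitiveRoot ω n)
    (h : MvPolynomial (Fin n × Fin n) NNReal) :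
    MvPolynomial.eval (fun rc : Fin n × Fin n => if rc.1 ∈ K then ω ^ (rc.2 : ℕ) else 1)
      (MvPolynomial.map (Complex.ofRealHom.comp NNReal.toRealHom) (perPoly (Fin n) NNReal * h)) = 0 := by
  sorry

/-- The h-free MASS IDENTITY it encodes: for `g = per_n · h` the coefficient mass of `g` is exactly
equidistributed over the `n` residue classes of the statistic
`s_K(u) = Σ_{r ∈ K} Σ_c c · u_{rc} (mod n)` — for every row set `K` with `1 ≤ |K| ≤ n - 1`. -/
def RowBlockEquidistribution : Prop :=
  ∀ (n : ℕ) (K : Finset (Fin n)), 0 < K.card → K.card < n →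
    ∀ (h : MvPolynomial (Fin n × Fin n) NNReal) (a : Fin n),
      (n : NNReal) * ∑ u ∈ (perPoly (Fin n) NNReal * h).support with
          (∑ rc ∈ u.support with rc.1 ∈ K, (rc.2 : ℕ) * u rc) % n = (a : ℕ),
            coeff u (perPoly (Fin n) NNReal * h)
        = ∑ u ∈ (perPoly (Fin n) NNReal * h).support, coeff u (perPoly (Fin n) NNReal * h)

end Summit.ValiantsHypothesis.ValiantsHypothesis.Cruxes.PerMultiplesHard.Ideator1

end
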